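import Mathlib.Data.Finset.Card
import Mathlib.Data.Finset.Union
import Mathlib.Algebra.Order.BigOperators.Group.Finset
import Mathlib.Algebra.Group.Action.Defs
import HarnessLib

/-!
# Hub cliques are small — the HUB-TRIANGLE LEMMA and K₄-freeness by pigeonhole

Cell `pub-hsemireg`, widening group W5, seat w5-n7-1 (gen 11); file of record `widen/W5/N7-FEASIBILITY-w5n7.md` (N7F)
§3.10 (a) (HUB-TRIANGLE LEMMA, «PROVED, two lines»; the csknsat-independent UNSAT route for the 20 triangle classes of
the (19,−8) level-1 census, §3.10 (b)) and §3.10 (f) («at (20,−8) the hub-triangle count gives only K₄-freeness by hand: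
light sets ≥ 3 in 10 lights»). HONEST FRAMING: pure pigeonhole. In a star design every hub `h_x` has a set `N x` of
light neighbours inside a fixed coordinate `y` (the `L` lights of `y`: 11 at (19,−8), 10 at (20,−8)); by the margins
`#(N x) ≥ 6 − #(heavy y-neighbours of h_x)` (≥ 4 at (19,−8), ≥ 3 at (20,−8) in the relevant classes); and two ADJACENT
hubs `h_x ~ h_z` have DISJOINT light-neighbour sets in `y` (a common light neighbour would close a triangle through a
margin-1 level, excluded by the light-level lemma — kernel form in `SliceTestBalance.light_level`). These MODEL facts
enter as hypotheses; the kernel checks the count: a clique `Q` of the hub–hub graph avoiding `y` gives `#Q` pairwise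
disjoint subsets of the `L` lights, so `#Q · s ≤ L`.

* `card_mul_le_card_of_disjoint` — `#Q` pairwise disjoint subsets of `L`, each of size `≥ s` ⇒ `#Q · s ≤ #L`.
* `no_hub_triangle` — (19,−8): three pairwise disjoint ≥ 4-subsets of an 11-set do not exist («12 ≤ 11»): the
  hub–hub graph is TRIANGLE-FREE at every n ≥ 4.
* `no_hub_K4` — (20,−8): four pairwise disjoint ≥ 3-subsets of a 10-set do not exist: the hub–hub graph is K₄-free.

Nothing here is a statement about a variety, a sheaf or a Hodge class, and nothing here bears on HC / HC_CM / HC_AV.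
-/

open Finset

namespace Summit.Ventures.HSemireg.StarFamilyHubCliques

variable {ι V : Type*} [DecidableEq V]

/-- **Pigeonhole for disjoint neighbour sets.** If the sets `N x`, `x ∈ Q`, are pairwise disjoint subsets of `L`, each
with at least `s` elements, then `#Q · s ≤ #L`. -/
theorem card_mul_le_card_of_disjoint (Q : Finset ι) (L : Finset V) (N : ι → Finset V) (s : ℕ)
    (hsub : ∀ x ∈ Q, N x ⊆ L) (hs : ∀ x ∈ Q, s ≤ (N x).card)
    (hdisj : ∀ x ∈ Q, ∀ z ∈ Q, x ≠ z → Disjoint (N x) (N z)) : Q.card * s ≤ L.card := by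
  calc Q.card * s ≤ ∑ x ∈ Q, (N x).card :=
        card_nsmul_le_sum Q _ s hs |>.trans_eq' (by rw [smul_eq_mul])
    _ = (Q.biUnion N).card := (card_biUnion hdisj).symm
    _ ≤ L.card := card_le_card (biUnion_subset.2 hsub)

/-- **HUB-TRIANGLE LEMMA, N7F §3.10 (a)** ((19,−8), margins (6,2,1¹¹)): if three hubs `x, z, w` (a triangle of the hub–hub
graph `A`) and a fourth coordinate `y` had pairwise disjoint light-neighbour sets of size ≥ 4 inside the 11 lights of `y`
— which the margins (`6 − a_xy − e(h_x, d_y) ≥ 4`) and the light-level lemma (adjacent hubs share no light neighbour)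
force — then `3 · 4 ≤ 11`: impossible. So `A` is triangle-free at every n ≥ 4. -/
theorem no_hub_triangle (Q : Finset ι) (L : Finset V) (N : ι → Finset V) (hQ : Q.card = 3) (hL : L.card = 11)
    (hsub : ∀ x ∈ Q, N x ⊆ L) (h4 : ∀ x ∈ Q, 4 ≤ (N x).card)
    (hdisj : ∀ x ∈ Q, ∀ z ∈ Q, x ≠ z → Disjoint (N x) (N z)) : False := by
  have := card_mul_le_card_of_disjoint Q L N 4 hsub h4 hdisj
  rw [hQ, hL] at this
  omega

/-- **K₄-FREENESS, N7F §3.10 (f)** ((20,−8), margins (6,2,2,1¹⁰)): four pairwise adjacent hubs and a fifth coordinate `y`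
would give four pairwise disjoint light-neighbour sets of size ≥ 3 inside the 10 lights of `y`; `4 · 3 ≤ 10` is false.
So the hub–hub graph is K₄-free (the hand count gives no more at this cell: light sets ≥ 3 in 10 lights). -/
theorem no_hub_K4 (Q : Finset ι) (L : Finset V) (N : ι → Finset V) (hQ : Q.card = 4) (hL : L.card = 10)
    (hsub : ∀ x ∈ Q, N x ⊆ L) (h3 : ∀ x ∈ Q, 3 ≤ (N x).card)
    (hdisj : ∀ x ∈ Q, ∀ z ∈ Q, x ≠ z → Disjoint (N x) (N z)) : False := by
  have := card_mul_le_card_of_disjoint Q L N 3 hsub h3 hdisj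
  rw [hQ, hL] at this
  omega

end Summit.Ventures.HSemireg.StarFamilyHubCliques
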